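import Literature.NumberTheory.ZetaValues.AperyLikeGeneratingFunctions
import Literature.NumberTheory.ZetaValues.WZSummation
import HarnessLib

/-!
# The Koecher–Leshchiner Apéry-like series for every odd zeta value (proof of `koecherLeshchiner_oddZeta`)

Topic `Literature/NumberTheory/ZetaValues`; proofs-only companion of `AperyLikeGeneratingFunctions.lean`, discharging
`Literature.NumberTheory.ZetaValues.koecherLeshchiner_oddZeta`: for every `r ≥ 0`,
`ζ(2r+3) = Σ_{k≥1} ((−1)^{k−1−r}/(k³ C(2k,k))) ((5/2) H_{k−1}({2}^r) + 2 Σ_{j=1}^{r} ((−1)^j/k^{2j}) H_{k−1}({2}^{r−j}))`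
[R. Tauraso, arXiv:2511.18034, §1 (display after (KL)); M. Koecher, Math. Intelligencer 2 (1980) 62–64; D. Leshchiner
1981] — the coefficient of `a^{2r}` in the Koecher–Leshchiner generating function
`Σ_r ζ(2r+3) a^{2r} = ½ Σ_{k≥1} ((−1)^{k−1}/(k³C(2k,k))) (5k²−a²)/(k²−a²) ∏_{m<k}(1 − a²/m²)` (`r = 1`: Koecher's `ζ(5)`,
`KoecherZetaFiveProofs.lean`).

## Proof (Wilf–Zeilberger, coefficientwise in `a²`, all `r` at once)

Kh. & T. Hessami Pilehrood (Electron. J. Combin. 15 (2008) #R35 = arXiv:0801.1591, §2) prove the generating function from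
the WZ pair `F = (−1)ⁿ k! (1+a)_n (1−a)_n / ((2n+k+1)! ((n+k+1)² − a²))`,
`G = (−1)ⁿ k! (1+a)_n (1−a)_n (5(n+1)² − a² + k² + 4k(n+1)) / ((2n+k+2)! ((n+k+1)² − a²)(2n+2))` and the summation
`Σ_k F(0,k) = Σ_n G(n,0)` ([ibid., Prop. 1]; `WZSummation.wz_tsum_eq_tsum`). We run the argument on the COEFFICIENTS of
`a^{2r}` (no analytic continuation, no coefficient extraction from the two sides; the device of `KoecherZetaFiveProofs`
for `r = 1`): with `c = (−1)ⁿ k! n!²/(2n+k+1)!`, `d = (n+k+1)²`, `ε_s(n) = (−1)^s H_n({2}^s)` (so that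
`(1+a)_n(1−a)_n = n!² Σ_s ε_s(n) a^{2s}`, `1/(d−a²) = Σ_j a^{2j}/d^{j+1}`): `F_r(n,k) = c Σ_{s+j=r} ε_s(n)/d^{j+1}` and,
because `5(n+1)²+k²+4k(n+1) − d = (2n+2)(2n+k+2)`, `G_r(n,k) = F_r(n,k) + c ε_r(n)/((2n+k+2)(2n+2))`. The WZ relation
for `(F_r, G_r)` (`kl_wz`) reduces, via `H_{n+1}({2}^{s+1}) = H_n({2}^{s+1}) + H_n({2}^s)/(n+1)²`, to two
factorial-ratio identities; the boundary terms vanish by `|c| ≤ 1/(2n+1)` and `0 ≤ H_n({2}^s) ≤ ∏_{m≤n}(1+m⁻²) ≤ e²`;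
`F_r(0,k) = (k+1)^{−2r−3}` and `G_r(n,0)` is the printed summand at `k = n+1`. All helpers are private theorems (no
definitions); the only public declaration is `koecherLeshchiner_oddZeta_holds`. HONEST FRAMING (cell pub-zeta5): an
IDENTITY for odd zeta values, not a diophantine approximation; nothing here bears on the irrationality of `ζ(5)`.
-/


open Finset Filter Topology

noncomputable section

namespace Literature.NumberTheory.ZetaValues

/-! ### The multiple harmonic sums `H_n({2}^s)` -/

/-- `H_n({2}^0) = 1`. [folklore] -/
private theorem mht_zero_right (n : ℕ) : multipleHarmonicTwo n 0 = 1 := by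
  rw [multipleHarmonicTwo, Finset.powersetCard_zero, sum_singleton, prod_empty]

/-- `H_0({2}^{s+1}) = 0`. [folklore] -/
private theorem mht_zero_succ (s : ℕ) : multipleHarmonicTwo 0 (s + 1) = 0 := by
  rw [multipleHarmonicTwo, show Finset.Icc 1 0 = (∅ : Finset ℕ) by rfl,
    Finset.powersetCard_eq_empty.2 (by simp), sum_empty]

/-- The recursion `H_{n+1}({2}^{s+1}) = H_n({2}^{s+1}) + H_n({2}^s)/(n+1)²`. [folklore] -/
private theorem mht_succ_succ (n s : ℕ) :
    multipleHarmonicTwo (n + 1) (s + 1) =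
      multipleHarmonicTwo n (s + 1) + 1 / ((n : ℝ) + 1) ^ 2 * multipleHarmonicTwo n s := by
  have hn : n + 1 ∉ Finset.Icc 1 n := by simp
  rw [multipleHarmonicTwo, multipleHarmonicTwo, multipleHarmonicTwo,
    ← Finset.insert_Icc_right_eq_Icc_add_one (by omega : 1 ≤ n + 1),
    Finset.powersetCard_succ_insert hn, Finset.sum_union, Finset.sum_image, Finset.mul_sum]
  · congr 1
    refine Finset.sum_congr rfl fun T hT => ?_
    rw [Finset.prod_insert fun h => hn ((Finset.mem_powersetCard.1 hT).1 h)]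
    push_cast
    ring
  · intro T₁ hT₁ T₂ hT₂ h
    have h₁ : n + 1 ∉ T₁ := fun h' => hn ((Finset.mem_powersetCard.1 hT₁).1 h')
    have h₂ : n + 1 ∉ T₂ := fun h' => hn ((Finset.mem_powersetCard.1 hT₂).1 h')
    rw [← Finset.erase_insert h₁, ← Finset.erase_insert h₂, h]
  · refine Finset.disjoint_left.2 fun T hT hT' => ?_
    obtain ⟨T', _, rfl⟩ := Finset.mem_image.1 hT'
    exact hn ((Finset.mem_powersetCard.1 hT).1 (Finset.mem_insert_self _ T'))

/-- `0 ≤ H_n({2}^s) ≤ ∏_{j=1}^{n} (1 + j⁻²) ≤ exp(Σ_{j ≤ n} j⁻²) ≤ e² < 8`. [folklore] -/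
private theorem mht_bounds (n s : ℕ) : 0 ≤ multipleHarmonicTwo n s ∧ multipleHarmonicTwo n s ≤ 8 := by
  refine ⟨sum_nonneg fun T _ => prod_nonneg fun j _ => by positivity, ?_⟩
  have h1 : multipleHarmonicTwo n s ≤ ∏ j ∈ Finset.Icc 1 n, (1 + 1 / (j : ℝ) ^ 2) := by
    rw [multipleHarmonicTwo, Finset.prod_one_add]
    exact Finset.sum_le_sum_of_subset_of_nonneg
      (fun T hT => Finset.mem_powerset.2 (Finset.mem_powersetCard.1 hT).1)
      fun T _ _ => prod_nonneg fun j _ => by positivity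
  have h2 : ∏ j ∈ Finset.Icc 1 n, (1 + 1 / (j : ℝ) ^ 2) ≤ Real.exp (∑ j ∈ Finset.Icc 1 n, 1 / (j : ℝ) ^ 2) := by
    rw [Real.exp_sum]
    exact Finset.prod_le_prod (fun j _ => by positivity) fun j _ => by
      linarith [Real.add_one_le_exp (1 / (j : ℝ) ^ 2)]
  have h3 : ∑ j ∈ Finset.Icc 1 n, 1 / (j : ℝ) ^ 2 ≤ 2 := by
    have h := sum_Ioo_inv_sq_le (α := ℝ) 0 (n + 1)
    rw [show Finset.Ioo 0 (n + 1) = Finset.Icc 1 n by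
      ext j; simp only [Finset.mem_Ioo, Finset.mem_Icc]; omega] at h
    norm_num at h
    simpa only [one_div] using h
  have h4 : Real.exp 2 ≤ 8 := by
    rw [show (2 : ℝ) = 1 + 1 by norm_num, Real.exp_add]
    nlinarith [Real.exp_one_lt_d9, Real.exp_pos 1]
  linarith [Real.exp_le_exp.2 h3]

/-! ### The signed coefficient sums `Σ_{s+j=r} ε_s(n)/D^{j+1}`, `ε_s(n) = (−1)^s H_n({2}^s)` -/

/-- The coefficient recursion of `∏_{m ≤ n+1}(1 − X/m²)/(D − X) = (1 − X/(n+1)²) · ∏_{m ≤ n}(1 − X/m²)/(D − X)`: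
`Σ_{s+j=r} ε_s(n+1)/D^{j+1} = Σ_{s+j=r} ε_s(n)/D^{j+1} − (n+1)⁻² (Σ_{s+j=r} ε_s(n)/D^{j} − ε_r(n))`. [folklore] -/
private theorem coeffSum_succ (n r : ℕ) (D : ℝ) :
    ∑ p ∈ antidiagonal r, (-1 : ℝ) ^ p.1 * multipleHarmonicTwo (n + 1) p.1 / D ^ (p.2 + 1) =
      ∑ p ∈ antidiagonal r, (-1 : ℝ) ^ p.1 * multipleHarmonicTwo n p.1 / D ^ (p.2 + 1) -
        1 / ((n : ℝ) + 1) ^ 2 *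
          (∑ p ∈ antidiagonal r, (-1 : ℝ) ^ p.1 * multipleHarmonicTwo n p.1 / D ^ p.2 -
            (-1 : ℝ) ^ r * multipleHarmonicTwo n r) := by
  rcases r with _ | r
  · simp [mht_zero_right]
  · rw [Finset.Nat.sum_antidiagonal_succ, Finset.Nat.sum_antidiagonal_succ,
      Finset.Nat.sum_antidiagonal_succ' (f := fun p : ℕ × ℕ =>
        (-1 : ℝ) ^ p.1 * multipleHarmonicTwo n p.1 / D ^ p.2)]
    simp only [mht_zero_right, pow_zero, mul_one, div_one]
    have e : ∀ p ∈ antidiagonal r,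
        (-1 : ℝ) ^ (p.1 + 1) * multipleHarmonicTwo (n + 1) (p.1 + 1) / D ^ (p.2 + 1) =
          (-1 : ℝ) ^ (p.1 + 1) * multipleHarmonicTwo n (p.1 + 1) / D ^ (p.2 + 1) -
            1 / ((n : ℝ) + 1) ^ 2 * ((-1 : ℝ) ^ p.1 * multipleHarmonicTwo n p.1 / D ^ (p.2 + 1)) := by
      intro p _
      rw [mht_succ_succ, pow_succ]
      ring
    rw [Finset.sum_congr rfl e, Finset.sum_sub_distrib, ← Finset.mul_sum]
    ring

/-- `Σ_{s+j=r} ε_s(n)/D^{j} = D · Σ_{s+j=r} ε_s(n)/D^{j+1}` (`D ≠ 0`). [folklore] -/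
private theorem coeffSum_mul (n r : ℕ) {D : ℝ} (hD : D ≠ 0) :
    ∑ p ∈ antidiagonal r, (-1 : ℝ) ^ p.1 * multipleHarmonicTwo n p.1 / D ^ p.2 =
      D * ∑ p ∈ antidiagonal r, (-1 : ℝ) ^ p.1 * multipleHarmonicTwo n p.1 / D ^ (p.2 + 1) := by
  rw [Finset.mul_sum]
  refine Finset.sum_congr rfl fun p _ => ?_
  rw [pow_succ]
  field_simp

/-- `|Σ_{s+j=r} ε_s(n)/D^{j+1}| ≤ 8(r+1)/D` for `D ≥ 1`. [folklore] -/
private theorem coeffSum_abs_le (n r : ℕ) {D : ℝ} (hD : 1 ≤ D) :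
    |∑ p ∈ antidiagonal r, (-1 : ℝ) ^ p.1 * multipleHarmonicTwo n p.1 / D ^ (p.2 + 1)| ≤
      8 * ((r : ℝ) + 1) / D := by
  have hD0 : 0 < D := one_pos.trans_le hD
  refine (Finset.abs_sum_le_sum_abs _ _).trans ?_
  have hterm : ∀ p ∈ antidiagonal r,
      |(-1 : ℝ) ^ p.1 * multipleHarmonicTwo n p.1 / D ^ (p.2 + 1)| ≤ 8 / D := by
    intro p _
    rw [abs_div, abs_mul, abs_pow, abs_neg, abs_one, one_pow, one_mul, abs_of_nonneg (mht_bounds _ _).1,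
      abs_of_pos (pow_pos hD0 _)]
    calc multipleHarmonicTwo n p.1 / D ^ (p.2 + 1) ≤ 8 / D ^ (p.2 + 1) := by
          gcongr; exact (mht_bounds _ _).2
      _ ≤ 8 / D := div_le_div_of_nonneg_left (by norm_num) hD0 (le_self_pow₀ hD (by omega))
  refine (Finset.sum_le_sum hterm).trans (le_of_eq ?_)
  rw [Finset.sum_const, Finset.Nat.card_antidiagonal, nsmul_eq_mul]
  push_cast
  ring

/-- At `n = 0` only `s = 0` contributes: `Σ_{s+j=r} ε_s(0)/D^{j+1} = 1/D^{r+1}`. [folklore] -/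
private theorem coeffSum_zero (r : ℕ) (D : ℝ) :
    ∑ p ∈ antidiagonal r, (-1 : ℝ) ^ p.1 * multipleHarmonicTwo 0 p.1 / D ^ (p.2 + 1) = 1 / D ^ (r + 1) := by
  rw [Finset.sum_eq_single (0, r)]
  · simp [mht_zero_right]
  · rintro ⟨s, j⟩ hp hne
    have hsj : s + j = r := by simpa using hp
    rcases s with _ | t
    · exact absurd (by rw [show j = r by omega]) hne
    · simp [mht_zero_succ]
  · exact fun h => absurd (by simp : ((0, r) : ℕ × ℕ) ∈ antidiagonal r) h

/-- Reindexing by `j` with the sign moved out: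
`Σ_{s+j=r} ε_s(n)/(K²)^{j+1} = ((−1)^r/K²) (H_n({2}^r) + Σ_{j=1}^{r} (−1)^j K^{−2j} H_n({2}^{r−j}))` (`K ≠ 0`). [folklore] -/
private theorem coeffSum_reindex (n r : ℕ) {K : ℝ} (hK : K ≠ 0) :
    ∑ p ∈ antidiagonal r, (-1 : ℝ) ^ p.1 * multipleHarmonicTwo n p.1 / (K ^ 2) ^ (p.2 + 1) =
      (-1 : ℝ) ^ r / K ^ 2 *
        (multipleHarmonicTwo n r +
          ∑ j ∈ Finset.Icc 1 r, (-1 : ℝ) ^ j / K ^ (2 * j) * multipleHarmonicTwo n (r - j)) := by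
  have hR : multipleHarmonicTwo n r +
      ∑ j ∈ Finset.Icc 1 r, (-1 : ℝ) ^ j / K ^ (2 * j) * multipleHarmonicTwo n (r - j) =
      ∑ j ∈ Finset.range (r + 1), (-1 : ℝ) ^ j / K ^ (2 * j) * multipleHarmonicTwo n (r - j) := by
    rw [Finset.sum_range_succ', ← Finset.Ico_add_one_right_eq_Icc, Finset.sum_Ico_eq_sum_range,
      show r + 1 - 1 = r by omega, add_comm (multipleHarmonicTwo n r)]
    congr 1
    · exact Finset.sum_congr rfl fun j _ => by rw [Nat.add_comm]
    · simp
  rw [hR, ← Finset.Nat.sum_antidiagonal_swap, Finset.Nat.sum_antidiagonal_eq_sum_range_succ_mk,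
    Finset.mul_sum]
  refine Finset.sum_congr rfl fun j hj => ?_
  have hjr : j ≤ r := by have := Finset.mem_range.1 hj; omega
  have hsign : (-1 : ℝ) ^ (r - j) = (-1 : ℝ) ^ r * (-1) ^ j := by
    have e1 : (-1 : ℝ) ^ (r - j) * (-1) ^ j = (-1) ^ r := by rw [← pow_add, Nat.sub_add_cancel hjr]
    have e2 : (-1 : ℝ) ^ j * (-1) ^ j = 1 := by rw [← mul_pow]; norm_num
    calc (-1 : ℝ) ^ (r - j) = (-1 : ℝ) ^ (r - j) * ((-1) ^ j * (-1) ^ j) := by rw [e2, mul_one]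
      _ = (-1 : ℝ) ^ r * (-1) ^ j := by rw [← mul_assoc, e1]
  simp only [Prod.swap_prod_mk]
  rw [hsign, pow_succ, ← pow_mul]
  field_simp

/-! ### The hypergeometric factor `k! n!²/(2n+k+1)!` and `C(2n+2,n+1)` -/

/-- Under `n ↦ n+1`: `k!(n+1)!²/(2n+k+3)! = (k! n!²/(2n+k+1)!) · (n+1)²/((2n+k+2)(2n+k+3))`. [folklore] -/
private theorem hyp_succ_n (n k : ℕ) :
    ((k.factorial : ℝ) * ((n + 1).factorial : ℝ) ^ 2 / ((2 * (n + 1) + k + 1).factorial : ℝ)) =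
      (k.factorial : ℝ) * (n.factorial : ℝ) ^ 2 / ((2 * n + k + 1).factorial : ℝ) *
        (((n : ℝ) + 1) ^ 2 / ((2 * (n : ℝ) + k + 2) * (2 * (n : ℝ) + k + 3))) := by
  have e1 : ((2 * (n + 1) + k + 1).factorial : ℝ) = (2 * (n : ℝ) + k + 3) * (2 * (n : ℝ) + k + 2) *
      ((2 * n + k + 1).factorial : ℝ) := by
    rw [show 2 * (n + 1) + k + 1 = (2 * n + k + 1) + 1 + 1 by ring, Nat.factorial_succ, Nat.factorial_succ]
    push_cast; ring
  have h1 : ((2 * n + k + 1).factorial : ℝ) ≠ 0 := by positivity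
  rw [e1, Nat.factorial_succ]
  push_cast
  field_simp

/-- Under `k ↦ k+1`: `(k+1)! n!²/(2n+k+2)! = (k! n!²/(2n+k+1)!) · (k+1)/(2n+k+2)`. [folklore] -/
private theorem hyp_succ_k (n k : ℕ) :
    (((k + 1).factorial : ℝ) * (n.factorial : ℝ) ^ 2 / ((2 * n + (k + 1) + 1).factorial : ℝ)) =
      (k.factorial : ℝ) * (n.factorial : ℝ) ^ 2 / ((2 * n + k + 1).factorial : ℝ) *
        (((k : ℝ) + 1) / (2 * (n : ℝ) + k + 2)) := by
  have e1 : ((2 * n + (k + 1) + 1).factorial : ℝ) = (2 * (n : ℝ) + k + 2) * ((2 * n + k + 1).factorial : ℝ) := by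
    rw [show 2 * n + (k + 1) + 1 = (2 * n + k + 1) + 1 by ring, Nat.factorial_succ]
    push_cast; ring
  have h1 : ((2 * n + k + 1).factorial : ℝ) ≠ 0 := by positivity
  rw [e1, Nat.factorial_succ]
  push_cast
  field_simp

/-- The hypergeometric factor is nonnegative and at most `n!²/(2n+1)! ≤ 1/(2n+1)`. [folklore] -/
private theorem hyp_bounds (n k : ℕ) :
    0 ≤ (k.factorial : ℝ) * (n.factorial : ℝ) ^ 2 / ((2 * n + k + 1).factorial : ℝ) ∧
      (k.factorial : ℝ) * (n.factorial : ℝ) ^ 2 / ((2 * n + k + 1).factorial : ℝ) ≤ 1 / (2 * (n : ℝ) + 1) := by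
  refine ⟨by positivity, ?_⟩
  have h := Nat.le_of_dvd (Nat.factorial_pos _) (Nat.factorial_mul_factorial_dvd_factorial_add k (2 * n + 1))
  have h' : (k.factorial : ℝ) * ((2 * n + 1).factorial : ℝ) ≤ ((2 * n + k + 1).factorial : ℝ) := by
    rw [show 2 * n + k + 1 = k + (2 * n + 1) by ring]; exact_mod_cast h
  have g := Nat.le_of_dvd (Nat.factorial_pos _) (Nat.factorial_mul_factorial_dvd_factorial_add n n)
  have g' : (n.factorial : ℝ) ^ 2 ≤ ((2 * n).factorial : ℝ) := by rw [sq, two_mul]; exact_mod_cast g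
  have e : ((2 * n + 1).factorial : ℝ) = (2 * (n : ℝ) + 1) * ((2 * n).factorial : ℝ) := by
    rw [Nat.factorial_succ]; push_cast; ring
  rw [div_le_div_iff₀ (by positivity) (by positivity), one_mul]
  calc (k.factorial : ℝ) * (n.factorial : ℝ) ^ 2 * (2 * (n : ℝ) + 1)
      ≤ (k.factorial : ℝ) * ((2 * n).factorial : ℝ) * (2 * (n : ℝ) + 1) := by gcongr
    _ = (k.factorial : ℝ) * ((2 * n + 1).factorial : ℝ) := by rw [e]; ring
    _ ≤ _ := h'

/-- `C(2n+2, n+1) = (2n+2)(2n+1)!/((n+1)² n!²)` in `ℝ`. [folklore] -/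
private theorem centralBinom_succ_eq (n : ℕ) :
    (((n + 1).centralBinom : ℕ) : ℝ) =
      (2 * (n : ℝ) + 2) * ((2 * n + 1).factorial : ℝ) / (((n : ℝ) + 1) ^ 2 * (n.factorial : ℝ) ^ 2) := by
  have h := Nat.choose_mul_factorial_mul_factorial (show n + 1 ≤ 2 * (n + 1) by omega)
  rw [show 2 * (n + 1) - (n + 1) = n + 1 by omega, ← Nat.centralBinom_eq_two_mul_choose,
    show 2 * (n + 1) = (2 * n + 1) + 1 by ring, Nat.factorial_succ (2 * n + 1), Nat.factorial_succ n] at h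
  have h' : (((n + 1).centralBinom : ℕ) : ℝ) * (((n : ℝ) + 1) * (n.factorial : ℝ)) *
      (((n : ℝ) + 1) * (n.factorial : ℝ)) = (2 * (n : ℝ) + 1 + 1) * ((2 * n + 1).factorial : ℝ) := by
    exact_mod_cast h
  rw [eq_div_iff (by positivity)]
  linear_combination h'

/-! ### The coefficientwise WZ pair -/

/-- **The `a^{2r}`-coefficient WZ pair of Koecher's identity**: with `c(n,k) = (−1)ⁿ k! n!²/(2n+k+1)!`,
`d = (n+k+1)²`, `ε_s(n) = (−1)^s H_n({2}^s)`, `F_r(n,k) = c(n,k) Σ_{s+j=r} ε_s(n)/d^{j+1}` and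
`G_r(n,k) = F_r(n,k) + c(n,k) ε_r(n)/((2n+k+2)(2n+2))` — the coefficients of `a^{2r}` of the printed pair
`F = (−1)ⁿk!(1+a)_n(1−a)_n/((2n+k+1)!((n+k+1)²−a²))`, `G = (−1)ⁿk!(1+a)_n(1−a)_n(5(n+1)²−a²+k²+4k(n+1))/((2n+k+2)!((n+k+1)²−a²)(2n+2))` —
`F_r(n+1,k) − F_r(n,k) = G_r(n,k+1) − G_r(n,k)`. [cite: HessamiPilehrood2008WZ, §2 (the WZ pair)] -/
private theorem kl_wz (r n k : ℕ) :
    let F : ℕ → ℕ → ℝ := fun n k =>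
      (-1 : ℝ) ^ n * ((k.factorial : ℝ) * (n.factorial : ℝ) ^ 2 / ((2 * n + k + 1).factorial : ℝ)) *
        ∑ p ∈ antidiagonal r, (-1 : ℝ) ^ p.1 * multipleHarmonicTwo n p.1 / (((n : ℝ) + k + 1) ^ 2) ^ (p.2 + 1)
    let G : ℕ → ℕ → ℝ := fun n k =>
      F n k + (-1 : ℝ) ^ n * ((k.factorial : ℝ) * (n.factorial : ℝ) ^ 2 / ((2 * n + k + 1).factorial : ℝ)) *
        ((-1 : ℝ) ^ r * multipleHarmonicTwo n r) / ((2 * (n : ℝ) + k + 2) * (2 * (n : ℝ) + 2))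
    F (n + 1) k - F n k = G n (k + 1) - G n k := by
  intro F G
  have hd2 : ((n : ℝ) + 1 + k + 1) ^ 2 ≠ 0 := by positivity
  simp only [F, G]
  rw [hyp_succ_n, hyp_succ_k, coeffSum_succ, pow_succ (-1 : ℝ) n]
  push_cast
  rw [show ((n : ℝ) + ((k : ℝ) + 1) + 1) ^ 2 = ((n : ℝ) + 1 + k + 1) ^ 2 by ring, coeffSum_mul n r hd2]
  have h1 : (n : ℝ) + k + 1 ≠ 0 := by positivity
  have h2 : (n : ℝ) + 1 + k + 1 ≠ 0 := by positivity
  have h4 : 2 * (n : ℝ) + k + 2 ≠ 0 := by positivity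
  have h5 : 2 * (n : ℝ) + k + 3 ≠ 0 := by positivity
  have h6 : 2 * (n : ℝ) + 2 ≠ 0 := by positivity
  have h7 : (n : ℝ) + 1 ≠ 0 := by positivity
  have h8 : 2 * (n : ℝ) + (k + 1) + 2 ≠ 0 := by positivity
  field_simp
  ring

/-- The analytic hypotheses of the WZ summation for `(F_r, G_r)`: from `|F_r(n,k)| ≤ 8(r+1)|c(n,k)|/(n+k+1)²`,
`|c(n,k)| ≤ 1/(2n+1)` and `H_n({2}^r) ≤ 8`, every row `F_r(n,·)` is summable, `G_r(n,k) → 0` (`k → ∞`),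
`Σ_k F_r(n,k) → 0` (`n → ∞`) and `G_r(·,0)` is summable. [folklore] -/
private theorem kl_pair_facts (r : ℕ) :
    let F : ℕ → ℕ → ℝ := fun n k =>
      (-1 : ℝ) ^ n * ((k.factorial : ℝ) * (n.factorial : ℝ) ^ 2 / ((2 * n + k + 1).factorial : ℝ)) *
        ∑ p ∈ antidiagonal r, (-1 : ℝ) ^ p.1 * multipleHarmonicTwo n p.1 / (((n : ℝ) + k + 1) ^ 2) ^ (p.2 + 1)
    let G : ℕ → ℕ → ℝ := fun n k =>
      F n k + (-1 : ℝ) ^ n * ((k.factorial : ℝ) * (n.factorial : ℝ) ^ 2 / ((2 * n + k + 1).factorial : ℝ)) *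
        ((-1 : ℝ) ^ r * multipleHarmonicTwo n r) / ((2 * (n : ℝ) + k + 2) * (2 * (n : ℝ) + 2))
    (∀ n, Summable (F n)) ∧ (∀ n, Tendsto (G n) atTop (𝓝 0)) ∧
      Tendsto (fun n => ∑' k, F n k) atTop (𝓝 0) ∧ Summable (fun n => G n 0) := by
  intro F G
  have hS2 : Summable fun k : ℕ => 1 / ((k : ℝ) + 1) ^ 2 := by
    simpa using (summable_nat_add_iff 1).2 (Real.summable_one_div_nat_pow.2 one_lt_two)
  have hF0 : ∀ n k : ℕ, ‖F n k‖ ≤ 8 * ((r : ℝ) + 1) *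
      ((k.factorial : ℝ) * (n.factorial : ℝ) ^ 2 / ((2 * n + k + 1).factorial : ℝ)) / ((n : ℝ) + k + 1) ^ 2 := by
    intro n k
    have hD1 : (1 : ℝ) ≤ ((n : ℝ) + k + 1) ^ 2 := by
      nlinarith [(n.cast_nonneg : (0 : ℝ) ≤ n), (k.cast_nonneg : (0 : ℝ) ≤ k)]
    rw [Real.norm_eq_abs]
    simp only [F]
    rw [abs_mul, abs_mul, abs_pow, abs_neg, abs_one, one_pow, one_mul, abs_of_nonneg (hyp_bounds n k).1]
    calc _ ≤ (k.factorial : ℝ) * (n.factorial : ℝ) ^ 2 / ((2 * n + k + 1).factorial : ℝ) *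
          (8 * ((r : ℝ) + 1) / ((n : ℝ) + k + 1) ^ 2) := by gcongr; exact coeffSum_abs_le n r hD1
      _ = _ := by ring
  have hFb : ∀ n k : ℕ, ‖F n k‖ ≤ 8 * ((r : ℝ) + 1) * (1 / (2 * (n : ℝ) + 1)) * (1 / ((k : ℝ) + 1) ^ 2) := by
    intro n k
    refine (hF0 n k).trans ?_
    rw [div_eq_mul_one_div]
    gcongr ?_ * ?_
    · exact mul_le_mul_of_nonneg_left (hyp_bounds n k).2 (by positivity)
    · exact div_le_div_of_nonneg_left zero_le_one (by positivity)
        (by nlinarith [(n.cast_nonneg : (0 : ℝ) ≤ n), (k.cast_nonneg : (0 : ℝ) ≤ k)])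
  have hGb : ∀ n k : ℕ, ‖G n k‖ ≤
      8 * ((r : ℝ) + 1) * (1 / ((n : ℝ) + k + 1) ^ 2) + 8 / ((2 * (n : ℝ) + k + 2) * (2 * (n : ℝ) + 2)) := by
    intro n k
    obtain ⟨hc0, hcb⟩ := hyp_bounds n k
    have hc1 : (k.factorial : ℝ) * (n.factorial : ℝ) ^ 2 / ((2 * n + k + 1).factorial : ℝ) ≤ 1 :=
      hcb.trans (by rw [div_le_one (by positivity)]; linarith [(n.cast_nonneg : (0 : ℝ) ≤ n)])
    have hE : (0 : ℝ) < (2 * (n : ℝ) + k + 2) * (2 * (n : ℝ) + 2) := by positivity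
    refine (norm_add_le _ _).trans (add_le_add ((hF0 n k).trans ?_) ?_)
    · rw [mul_one_div]
      exact div_le_div_of_nonneg_right (mul_le_of_le_one_right (by positivity) hc1) (by positivity)
    · rw [Real.norm_eq_abs, abs_div, abs_mul, abs_mul, abs_pow, abs_neg, abs_one, one_pow, one_mul,
        abs_of_nonneg hc0, abs_of_pos hE, abs_mul, abs_pow, abs_neg, abs_one, one_pow, one_mul,
        abs_of_nonneg (mht_bounds _ _).1]
      gcongr
      calc (k.factorial : ℝ) * (n.factorial : ℝ) ^ 2 / ((2 * n + k + 1).factorial : ℝ) * multipleHarmonicTwo n r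
          ≤ 1 * 8 := mul_le_mul hc1 (mht_bounds _ _).2 (mht_bounds _ _).1 zero_le_one
        _ = 8 := one_mul _
  refine ⟨fun n => Summable.of_norm_bounded (hS2.mul_left _) (hFb n), fun n => ?_, ?_, ?_⟩
  · -- `G_r(n,k) → 0`
    refine squeeze_zero_norm (hGb n) ?_
    rw [show (0 : ℝ) = 8 * ((r : ℝ) + 1) * 0 + 0 by ring]
    have ht : Tendsto (fun k : ℕ => (n : ℝ) + k + 1) atTop atTop :=
      tendsto_atTop_add_const_right _ _ (tendsto_atTop_add_const_left _ _ tendsto_natCast_atTop_atTop)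
    refine ((tendsto_const_nhds.div_atTop ?_).const_mul _).add (tendsto_const_nhds.div_atTop ?_)
    · simpa only [sq] using ht.atTop_mul_atTop₀ ht
    · exact Tendsto.atTop_mul_const (by positivity)
        (tendsto_atTop_add_const_right _ _ (tendsto_atTop_add_const_left _ _ tendsto_natCast_atTop_atTop))
  · -- `Σ_k F_r(n,k) → 0`
    have hle : ∀ n : ℕ, ‖∑' k, F n k‖ ≤
        8 * ((r : ℝ) + 1) * (1 / (2 * (n : ℝ) + 1)) * ∑' k : ℕ, 1 / ((k : ℝ) + 1) ^ 2 :=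
      fun n => tsum_of_norm_bounded (hS2.hasSum.mul_left _) (hFb n)
    refine squeeze_zero_norm hle ?_
    have hlim : Tendsto (fun n : ℕ => 8 * ((r : ℝ) + 1) * (1 / (2 * (n : ℝ) + 1)) *
        ∑' k : ℕ, 1 / ((k : ℝ) + 1) ^ 2) atTop (𝓝 (8 * ((r : ℝ) + 1) * 0 * ∑' k : ℕ, 1 / ((k : ℝ) + 1) ^ 2)) :=
      ((tendsto_const_nhds.div_atTop (tendsto_atTop_add_const_right _ _
        (tendsto_natCast_atTop_atTop.const_mul_atTop two_pos))).const_mul _).mul_const _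
    simpa using hlim
  · -- `G_r(·,0)` summable
    refine Summable.of_norm_bounded (hS2.mul_left (8 * ((r : ℝ) + 1) + 8)) fun n => (hGb n 0).trans ?_
    have hn : (0 : ℝ) ≤ n := n.cast_nonneg
    rw [Nat.cast_zero, add_zero, add_zero]
    have h1 : 8 / ((2 * (n : ℝ) + 2) * (2 * (n : ℝ) + 2)) ≤ 8 * (1 / ((n : ℝ) + 1) ^ 2) := by
      rw [mul_one_div]
      exact div_le_div_of_nonneg_left (by norm_num) (by positivity) (by nlinarith)
    linarith

/-! ### Assembly -/

/-- **Koecher–Leshchiner: the explicit Apéry-like series for every odd zeta value** (discharge of the named fact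
`koecherLeshchiner_oddZeta`): for every `r ≥ 0`,
`ζ(2r+3) = Σ_{k≥1} ((−1)^{k−1−r}/(k³ C(2k,k))) ((5/2) H_{k−1}({2}^r) + 2 Σ_{j=1}^{r} ((−1)^j/k^{2j}) H_{k−1}({2}^{r−j}))`,
by WZ summation of the `a^{2r}`-coefficients `(F_r, G_r)` of the Hessami Pilehrood pair for the Koecher–Leshchiner
generating function: `F_r(0,k) = (k+1)^{−2r−3}` and `G_r(n,0)` is the printed summand at `k = n+1`.
[cite: Tauraso2025, §1 (display after (KL))] [cite: Koecher1980, (generating function of ζ(2n+3))]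
[cite: HessamiPilehrood2008WZ, §2 (the WZ pair) and §1 Proposition 1] -/
theorem koecherLeshchiner_oddZeta_holds : koecherLeshchiner_oddZeta := by
  intro r
  obtain ⟨hFs, hGt, hFt, hG0⟩ := kl_pair_facts r
  have key := wz_tsum_eq_tsum (fun n k => kl_wz r n k) hFs hGt hFt hG0
  have hS : Summable fun n : ℕ => 1 / (n : ℝ) ^ (2 * r + 3) :=
    Real.summable_one_div_nat_pow.2 (by omega)
  rw [Literature.NumberTheory.Transcendental.zetaValue, hS.tsum_eq_zero_add]
  convert key using 1
  · -- the left-hand side: `F_r(0,k) = (k+1)^{−(2r+3)}`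
    rw [Nat.cast_zero, zero_pow (by omega), div_zero, zero_add]
    refine tsum_congr fun k => ?_
    rw [coeffSum_zero, show 2 * 0 + k + 1 = k + 1 by ring, Nat.factorial_succ, ← pow_mul]
    push_cast
    have hk : (k.factorial : ℝ) ≠ 0 := by positivity
    have hk1 : (k : ℝ) + 1 ≠ 0 := by positivity
    rw [pow_zero, one_mul, Nat.factorial_zero, Nat.cast_one, one_pow, mul_one, zero_add,
      show (2 : ℕ) * (r + 1) = (2 * r + 3) - 1 by omega, pow_sub₀ _ hk1 (by omega), pow_one]
    field_simp
  · -- the right-hand side: `G_r(n,0)` is the printed summand at `k = n+1`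
    refine tsum_congr fun n => ?_
    have hK : (n : ℝ) + 1 ≠ 0 := by positivity
    simp only [Nat.cast_zero, add_zero, Nat.factorial_zero, Nat.cast_one, one_mul]
    rw [coeffSum_reindex n r hK, centralBinom_succ_eq n, pow_add, pow_add, neg_one_sq, mul_one]
    push_cast
    have h1 : (n.factorial : ℝ) ≠ 0 := by positivity
    have h2 : ((2 * n + 1).factorial : ℝ) ≠ 0 := by positivity
    have h4 : 2 * (n : ℝ) + 2 ≠ 0 := by positivity
    field_simp
    ring

end Literature.NumberTheory.ZetaValues
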